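import Summits.AtomisticToContinuum.Crystallization.Theorems.FrustratedLawDichotomyCollarNonExemptZones
import Summits.AtomisticToContinuum.Crystallization.Theorems.FrustratedLawDichotomyBregmanMenu

/-!
# FrustratedLawDichotomy · crux `AperiodicFrustratedLawGap` (stmt-AtomisticToContinuum-27623) — BINNED Bregman constants and interval forms of the
# norm / quadratic-form hypotheses: the last kernel pieces a rational cell checker needs for the move test (decomp-a2c, prover hand 2, generation 17)

A `decide`-style checker for `¬MoveUnstableCore` at the class centres of a supercell motif (the X-kernel binder `hnex`, cf. `…CollarKillGlue`) meets
≈ 2 200 bonds per class.  Two things keep it cheap and sound: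

* §1 ★ BINNED MENU: the Bregman constant of `…BregmanMenu` is certified ONCE PER BIN of squared bond lengths `Q ∈ [Q_lo, Q_hi]` instead of once per bond —
  `Pos(u, ·)` and `Neg(u, ·)` are increasing in `u = Q⁻¹ ≥ 0` (`pos_mono_u`, `neg_mono_u`), so the one-piece condition with `Pos` evaluated at `u_lo = Q_hi⁻¹`
  and `Neg` at `u_hi = Q_lo⁻¹` is valid for every `Q` in the bin (`bregman_ge_of_posNeg_bin`, chain form `bregman_ge_of_bin_chain`); the bin's move range is
  `[(r_lo − t)², (r_hi + t)²]` for enclosures `r_lo² ≤ Q_lo`, `Q_hi ≤ r_hi²` (`sq_dist_mem_range_bin`).  Float calibration (hand-2 g17 `calc/movecert.py`): geometric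
  `Q`-bins of ratio `1.01` (≈ 240 occupied bins per class), 16 pieces: cellT3 still certifies with two zones (inner margin `2.7·10⁻⁵`), TEQ15 isotropically.
* §2 INTERVAL FORMS: the exact sums `S = Σ Ṽ'(Q_k)` and `F_a = Σ 2Ṽ'(Q_k) w_k a` are huge rationals, so a checker rounds per term; the kernels consume
  a lower bound `S_lo ≤ S` (`hA_of_ldl_lo`: the 3×3 `LDLᵀ` certificate of `…CollarNonExemptCoords.hA_of_ldl` with `S_lo` in place of `S`) and coordinate
  enclosures of the force (`norm_le_of_abs_coords`, `norm_sum_smul_le_of_enclosures`: `‖F‖ ≤ φ_F` from `|F_a − f_a| ≤ τ` and `Σ_a (|f_a| + τ)² ≤ φ_F²`).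
All `[folklore]` (elementary real algebra); 0 sorry; no definitions.
-/

noncomputable section

namespace Summit.AtomisticToContinuum.Crystallization.Theorems.FrustratedLawDichotomyCollarNonExemptBins

open scoped BigOperators Classical RealInnerProductSpace
open Literature.Algebra.EuclideanLattices (inner_fin_three norm_sq_fin_three)
open Summit.AtomisticToContinuum.Crystallization.Theorems.FrustratedLawDichotomyBregmanMenu
open Summit.AtomisticToContinuum.Crystallization.Theorems.FrustratedLawDichotomyCollarNonExempt (sq_dist_mem_range)
open Summit.AtomisticToContinuum.Crystallization.Theorems.FrustratedLawDichotomyCollarNonExemptCoords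
  (sum_smul_apply sum_mul_inner_sq_eq_coords quadForm_ge_of_ldl)
open Summit.AtomisticToContinuum.Crystallization.Theorems.FrustratedLawDichotomyCollarNonExemptAniso (inner_sum_smul_eq_coords abs_apply_le_norm)

/-! ## §1. Binned Bregman constants -/

/-- `Pos(u, a) = u²a(6u⁵ + 5u⁴a + 4u³a² + 3u²a³ + 2ua⁴ + a⁵)` is increasing in `u ≥ 0` (`a ≥ 0`). [folklore] -/
theorem pos_mono_u {u u' a : ℝ} (hu : 0 ≤ u) (huu : u ≤ u') (ha : 0 ≤ a) :
    u ^ 2 * a * (6 * u ^ 5 + 5 * u ^ 4 * a + 4 * u ^ 3 * a ^ 2 + 3 * u ^ 2 * a ^ 3 + 2 * u * a ^ 4 + a ^ 5) ≤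
      u' ^ 2 * a * (6 * u' ^ 5 + 5 * u' ^ 4 * a + 4 * u' ^ 3 * a ^ 2 + 3 * u' ^ 2 * a ^ 3 + 2 * u' * a ^ 4 + a ^ 5) := by
  have hu' : 0 ≤ u' := hu.trans huu
  gcongr

/-- `Neg(u, b) = u²b(6u² + 4ub + 2b²)` is increasing in `u ≥ 0` (`b ≥ 0`). [folklore] -/
theorem neg_mono_u {u u' b : ℝ} (hu : 0 ≤ u) (huu : u ≤ u') (hb : 0 ≤ b) :
    u ^ 2 * b * (6 * u ^ 2 + 4 * u * b + 2 * b ^ 2) ≤ u' ^ 2 * b * (6 * u' ^ 2 + 4 * u' * b + 2 * b ^ 2) := by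
  have hu' : 0 ≤ u' := hu.trans huu
  gcongr

/-- ★ **BINNED MENU ENTRY (one piece)**: for `0 < Q_lo ≤ Q ≤ Q_hi`, `0 < Plo ≤ P ≤ Phi` and
`12 c ≤ Pos(Q_hi⁻¹, Phi⁻¹) − Neg(Q_lo⁻¹, Plo⁻¹)`, the Bregman constant `c` is valid at `(Q, P)`. [folklore] -/
theorem bregman_ge_of_posNeg_bin {Q Qlo Qhi P Plo Phi c : ℝ} (hQlo : 0 < Qlo) (hQ1 : Qlo ≤ Q) (hQ2 : Q ≤ Qhi) (hPlo : 0 < Plo)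
    (h1 : Plo ≤ P) (h2 : P ≤ Phi)
    (hc : 12 * c ≤ Qhi⁻¹ ^ 2 * Phi⁻¹ * (6 * Qhi⁻¹ ^ 5 + 5 * Qhi⁻¹ ^ 4 * Phi⁻¹ + 4 * Qhi⁻¹ ^ 3 * Phi⁻¹ ^ 2 + 3 * Qhi⁻¹ ^ 2 * Phi⁻¹ ^ 3 +
        2 * Qhi⁻¹ * Phi⁻¹ ^ 4 + Phi⁻¹ ^ 5) - Qlo⁻¹ ^ 2 * Plo⁻¹ * (6 * Qlo⁻¹ ^ 2 + 4 * Qlo⁻¹ * Plo⁻¹ + 2 * Plo⁻¹ ^ 2)) :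
    c * (P - Q) ^ 2 ≤
      ((1 / 12) * P⁻¹ ^ 6 - (1 / 6) * P⁻¹ ^ 3) - ((1 / 12) * Q⁻¹ ^ 6 - (1 / 6) * Q⁻¹ ^ 3) -
        (-(1 / 2) * Q⁻¹ ^ 7 + (1 / 2) * Q⁻¹ ^ 4) * (P - Q) := by
  have hQ : 0 < Q := hQlo.trans_le hQ1
  have hQhi : 0 < Qhi := hQ.trans_le hQ2
  have hP : 0 < P := hPlo.trans_le h1
  have hPhi : 0 < Phi := hP.trans_le h2
  refine bregman_ge_of_posNeg hQ hPlo h1 h2 (hc.trans ?_)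
  have hulo : Qhi⁻¹ ≤ Q⁻¹ := inv_anti₀ hQ hQ2
  have huhi : Q⁻¹ ≤ Qlo⁻¹ := inv_anti₀ hQlo hQ1
  have hpos := pos_mono_u (inv_nonneg.2 hQhi.le) hulo (inv_nonneg.2 hPhi.le)
  have hneg := neg_mono_u (inv_nonneg.2 hQ.le) huhi (inv_nonneg.2 hPlo.le)
  linarith

/-- ★★ **BINNED MENU ENTRY (chain of pieces)**: a chain `Plo = e 0 ≤ … ≤ e n = Phi` (`0 < e 0`, `0 < n`) with the binned one-piece condition on every
piece gives a Bregman constant valid for EVERY `Q ∈ [Q_lo, Q_hi]` and every `P ∈ [Plo, Phi]` — the `hbreg` hypothesis for all bonds of the bin at once.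
[folklore] -/
theorem bregman_ge_of_bin_chain (e : ℕ → ℝ) {n : ℕ} {Qlo Qhi c : ℝ} (hQlo : 0 < Qlo) (he0 : 0 < e 0) (hmono : ∀ i, i < n → e i ≤ e (i + 1))
    (hn : 0 < n)
    (hc : ∀ i, i < n → 12 * c ≤ Qhi⁻¹ ^ 2 * (e (i + 1))⁻¹ * (6 * Qhi⁻¹ ^ 5 + 5 * Qhi⁻¹ ^ 4 * (e (i + 1))⁻¹ + 4 * Qhi⁻¹ ^ 3 * (e (i + 1))⁻¹ ^ 2 +
        3 * Qhi⁻¹ ^ 2 * (e (i + 1))⁻¹ ^ 3 + 2 * Qhi⁻¹ * (e (i + 1))⁻¹ ^ 4 + (e (i + 1))⁻¹ ^ 5) -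
      Qlo⁻¹ ^ 2 * (e i)⁻¹ * (6 * Qlo⁻¹ ^ 2 + 4 * Qlo⁻¹ * (e i)⁻¹ + 2 * (e i)⁻¹ ^ 2)) :
    ∀ Q P : ℝ, Qlo ≤ Q → Q ≤ Qhi → e 0 ≤ P → P ≤ e n →
      c * (P - Q) ^ 2 ≤
        ((1 / 12) * P⁻¹ ^ 6 - (1 / 6) * P⁻¹ ^ 3) - ((1 / 12) * Q⁻¹ ^ 6 - (1 / 6) * Q⁻¹ ^ 3) -
          (-(1 / 2) * Q⁻¹ ^ 7 + (1 / 2) * Q⁻¹ ^ 4) * (P - Q) := by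
  have hpos : ∀ i, i ≤ n → 0 < e i := by
    intro i hi
    induction i with
    | zero => exact he0
    | succ i ih => exact (ih (Nat.le_of_succ_le hi)).trans_le (hmono i (Nat.lt_of_succ_le hi))
  intro Q P hQ1 hQ2 h0 hP
  obtain ⟨i, hi, h1, h2⟩ := exists_piece_of_chain e h0 hP hn
  exact bregman_ge_of_posNeg_bin hQlo hQ1 hQ2 (hpos i hi.le) h1 h2 (hc i hi)

/-- ★ **The bin's move range**: with squared-length enclosures `rlo² ≤ Q = dist a b ²`, `Q ≤ rhi²` (`0 ≤ rlo`, `0 ≤ rhi`), `t ≤ rlo` and a move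
`dist p a ≤ t`, the moved squared length lies in `[(rlo − t)², (rhi + t)²]`. [folklore] -/
theorem sq_dist_mem_range_bin {t rlo rhi : ℝ} {p a b : EuclideanSpace ℝ (Fin 3)} (hrlo : 0 ≤ rlo) (hrhi : 0 ≤ rhi)
    (hlo : rlo ^ 2 ≤ dist a b ^ 2) (hhi : dist a b ^ 2 ≤ rhi ^ 2) (ht : t ≤ rlo) (hp : dist p a ≤ t) :
    (rlo - t) ^ 2 ≤ dist p b ^ 2 ∧ dist p b ^ 2 ≤ (rhi + t) ^ 2 := by
  have h1 : rlo ≤ dist a b := (pow_le_pow_iff_left₀ hrlo dist_nonneg two_ne_zero).1 hlo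
  have h2 : dist a b ≤ rhi := (pow_le_pow_iff_left₀ dist_nonneg hrhi two_ne_zero).1 hhi
  exact sq_dist_mem_range h1 h2 ht hp

/-! ## §2. Interval forms of the quadratic-form and norm hypotheses -/

/-- ★ **`hA` from an `LDLᵀ` certificate with a LOWER BOUND `S_lo ≤ S`** of the (irrational-sized) sum `S = Σ Ṽ'(Q_k)`: the certificate of
`…CollarNonExemptCoords.hA_of_ldl` for the matrix `S_lo·I + 4Σ c_k w_k w_kᵀ` gives `hA` for the true `S`. [folklore] -/
theorem hA_of_ldl_lo {N : ℕ} (s : Finset (Fin N)) (c dV : Fin N → ℝ) (w : Fin N → EuclideanSpace ℝ (Fin 3))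
    {Slo lam l10 l20 l21 d0 d1 d2 : ℝ} (hS : Slo ≤ ∑ k ∈ s, dV k) (hd0 : 0 ≤ d0) (hd1 : 0 ≤ d1) (hd2 : 0 ≤ d2)
    (h00 : Slo + 4 * (∑ k ∈ s, c k * w k 0 ^ 2) - lam = d0)
    (h01 : 4 * (∑ k ∈ s, c k * (w k 0 * w k 1)) = l10 * d0)
    (h02 : 4 * (∑ k ∈ s, c k * (w k 0 * w k 2)) = l20 * d0)
    (h11 : Slo + 4 * (∑ k ∈ s, c k * w k 1 ^ 2) - lam = l10 ^ 2 * d0 + d1)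
    (h12 : 4 * (∑ k ∈ s, c k * (w k 1 * w k 2)) = l20 * l10 * d0 + l21 * d1)
    (h22 : Slo + 4 * (∑ k ∈ s, c k * w k 2 ^ 2) - lam = l20 ^ 2 * d0 + l21 ^ 2 * d1 + d2) :
    ∀ v : EuclideanSpace ℝ (Fin 3), lam * ‖v‖ ^ 2 ≤ (∑ k ∈ s, dV k) * ‖v‖ ^ 2 + 4 * ∑ k ∈ s, c k * ⟪w k, v⟫ ^ 2 := by
  intro v
  have h := quadForm_ge_of_ldl hd0 hd1 hd2 h00 h01 h02 h11 h12 h22 (v 0) (v 1) (v 2)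
  have hSv : Slo * ‖v‖ ^ 2 ≤ (∑ k ∈ s, dV k) * ‖v‖ ^ 2 := mul_le_mul_of_nonneg_right hS (sq_nonneg _)
  rw [norm_sq_fin_three] at hSv ⊢
  rw [sum_mul_inner_sq_eq_coords]
  linarith

/-- A norm bound from coordinate bounds: `|x_a| ≤ g_a`, `0 ≤ φ`, `g₀² + g₁² + g₂² ≤ φ²` ⟹ `‖x‖ ≤ φ`. [folklore] -/
theorem norm_le_of_abs_coords {x : EuclideanSpace ℝ (Fin 3)} (g : Fin 3 → ℝ) {φ : ℝ} (hφ : 0 ≤ φ) (hg : ∀ a, |x a| ≤ g a)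
    (h : g 0 ^ 2 + g 1 ^ 2 + g 2 ^ 2 ≤ φ ^ 2) : ‖x‖ ≤ φ := by
  have h0 := hg 0
  have h1 := hg 1
  have h2 := hg 2
  have e0 : x 0 ^ 2 ≤ g 0 ^ 2 := by rw [← sq_abs (x 0)]; exact pow_le_pow_left₀ (abs_nonneg _) h0 2
  have e1 : x 1 ^ 2 ≤ g 1 ^ 2 := by rw [← sq_abs (x 1)]; exact pow_le_pow_left₀ (abs_nonneg _) h1 2
  have e2 : x 2 ^ 2 ≤ g 2 ^ 2 := by rw [← sq_abs (x 2)]; exact pow_le_pow_left₀ (abs_nonneg _) h2 2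
  have hx : ‖x‖ ^ 2 ≤ φ ^ 2 := by rw [norm_sq_fin_three]; linarith
  exact (pow_le_pow_iff_left₀ (norm_nonneg x) hφ two_ne_zero).1 hx

/-- ★ **`hF` / `hB` from coordinate ENCLOSURES**: `|Σ_k a_k w_k a − f_a| ≤ τ` for the three coordinates, `0 ≤ φ` and `Σ_a (|f_a| + τ)² ≤ φ²`
⟹ `‖Σ_k a_k • w_k‖ ≤ φ`. [folklore] -/
theorem norm_sum_smul_le_of_enclosures {N : ℕ} (s : Finset (Fin N)) (a : Fin N → ℝ) (w : Fin N → EuclideanSpace ℝ (Fin 3)) (f : Fin 3 → ℝ)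
    {τ φ : ℝ} (hφ : 0 ≤ φ) (henc : ∀ i : Fin 3, |(∑ k ∈ s, a k * w k i) - f i| ≤ τ)
    (h : (|f 0| + τ) ^ 2 + (|f 1| + τ) ^ 2 + (|f 2| + τ) ^ 2 ≤ φ ^ 2) : ‖∑ k ∈ s, a k • w k‖ ≤ φ := by
  refine norm_le_of_abs_coords (fun i => |f i| + τ) hφ (fun i => ?_) h
  rw [sum_smul_apply]
  have h1 := abs_le.1 (henc i)
  rw [abs_le]
  constructor <;> cases abs_cases (f i) <;> linarith [h1.1, h1.2]

/-- The lower bound `C₄⁻ ≤ Σ c_k` and `C₄⁻ ≤ 0` from an exact sum and a case split (checker evaluation order). [folklore] -/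
theorem c4m_of_sum {σ C4m : ℝ} (h : (σ ≤ 0 ∧ C4m = σ) ∨ (0 ≤ σ ∧ C4m = 0)) : C4m ≤ σ ∧ C4m ≤ 0 := by
  rcases h with ⟨h1, h2⟩ | ⟨h1, h2⟩
  · exact ⟨h2.le, h2 ▸ h1⟩
  · exact ⟨h2 ▸ h1, h2.le⟩

end Summit.AtomisticToContinuum.Crystallization.Theorems.FrustratedLawDichotomyCollarNonExemptBins

end
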